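import Summits.ValiantsHypothesis.ValiantsHypothesis.Theorems.SymPencilSingFiveZeroRowBridge
import Summits.ValiantsHypothesis.ValiantsHypothesis.Theorems.SymPencilSingFiveClassification

/-!
# Route `SymPencil` — row `r = 11` of the size-`28` table: the `(11, 5)` dispatch at FIVE squares
# (`--supports` stmt-ValiantsHypothesis-5674 `SdcSuperquadratic`; part (d) of the `(11, 5, 5)` plan; rung currency only —
# nothing here bears on `VP ≠ VNP`)

Row `r = 11` of the size-`28` kernel-package table needs «no `5`-dimensional `W ⊆ Sing₃` carries a JOINT family of FIVE
squares» (`27 - 2·11 = 5`).  This file is the five-square twin of the ✓ size-`27` dispatch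
`SymPencilSingFiveClassification.noJointFamily_five_four_of`, written so that every ✓ leaf of the four-square cascade is
cited BY NAME:

* the top split is ✓ `zeroLine` (T5); a zero column is transposed into a zero row (`jointFive_map_transposeL`);
* on a `W` with a ZERO ROW the per-direction family of five squares is one of FOUR squares — the bridge
  ✓ `SymPencilSingFiveZeroRowBridge.perDirFour_of_perDirFive_of_zeroRow` — so ✓ `leafX`, ✓ `leafR2`, ✓ `leafR1C` and
  ✓ `threeRowsFourCols` (leaf R1N with its TORIC / PRODUCT residual) apply verbatim (`rowBranch_five_of`);
* the three five-square inputs are taken as HYPOTHESES here (`noJointFamily_five_five_of`), to be discharged by name: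
  `hX5` = leaf X at five (a `5`-dimensional `W` in a cross with a per-direction family of five squares is of `V₅×`-type),
  `hE5` = leaf E at five (a `5`-dimensional `W ⊆ W_col(p,q;m)` carries no JOINT family of five squares — discriminant parity
  for the non-torus hyperplanes, the torus bricks at five for the torus ones), `hXT5` = the `V₅×` brick at five.

Honest framing: dispatch only, conditional on the three named inputs; row `11` and `28 ≤ sdc(per₄) ≤ 29` UNCHANGED by this file
alone; stmt-5674 `SdcSuperquadratic` OPEN; `VP ≠ VNP` not moved; no summit statement is proved here.  No definitions, no named
facts. [folklore]
-/

noncomputable section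

-- single-conjunct layout: Sub = Summit, duplicated namespace component intended
set_option linter.dupNamespace false

namespace Summit.ValiantsHypothesis.ValiantsHypothesis.Theorems.SymPencilSingFiveClassificationFive

open MvPolynomial Module Matrix
open Literature.Computability.AlgebraicComplexity
open Summit.ValiantsHypothesis.ValiantsHypothesis.Theorems
open Summit.ValiantsHypothesis.ValiantsHypothesis.Theorems.SymPencilSingSixClassification
open Summit.ValiantsHypothesis.ValiantsHypothesis.Theorems.SymPencilPerFourJointFamilyTransport
open Summit.ValiantsHypothesis.ValiantsHypothesis.Theorems.SymPencilSingFiveClassification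
open Summit.ValiantsHypothesis.ValiantsHypothesis.Theorems.SymPencilSingFiveZeroRowBridge

variable {K : Type*} [Field K]

/-! ## 1. Projections and transports of a joint family of five squares -/

/-- A joint family of five squares is a per-direction family of five squares (`Λ_k = β_k(·, y)`). [folklore] -/
theorem perDirFive_of_jointFive {W : Submodule K (Fin 4 × Fin 4 → K)} {c : Fin 5 → K}
    {β : Fin 5 → ((Fin 4 × Fin 4 → K) →ₗ[K] (Fin 4 × Fin 4 → K) →ₗ[K] K)}
    (h : ∀ u : Fin 4 × Fin 4 → K, ∀ y ∈ W, ∃ e₀ e₁ : K, ∀ s : K,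
      eval (u + s • y) (perPoly (Fin 4) K) = e₀ + s * e₁ + s ^ 2 * ∑ k, c k * (β k u y) ^ 2) :
    ∀ y ∈ W, ∃ (c : Fin 5 → K) (Λ : Fin 5 → ((Fin 4 × Fin 4 → K) →ₗ[K] K)),
      ∀ u : Fin 4 × Fin 4 → K, ∃ e₀ e₁ : K, ∀ s : K,
        eval (u + s • y) (perPoly (Fin 4) K) = e₀ + s * e₁ + s ^ 2 * ∑ k, c k * (Λ k u) ^ 2 := by
  intro y hy
  refine ⟨c, fun k => (β k).flip y, fun u => ?_⟩
  obtain ⟨e₀, e₁, he⟩ := h u y hy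
  exact ⟨e₀, e₁, fun s => by simpa only [LinearMap.flip_apply] using he s⟩

/-- **Zero row ⇒ four squares per direction**: on a `W` with a zero row, a joint family of FIVE squares yields a
per-direction family of FOUR squares (`PerDirFour W` unfolded) — the bridge
✓ `perDirFour_of_perDirFive_of_zeroRow` after `perDirFive_of_jointFive`. [folklore] -/
theorem perDirFour_of_jointFive_of_zeroRow [CharZero K] {W : Submodule K (Fin 4 × Fin 4 → K)} {i : Fin 4}
    (hrow : ∀ x ∈ W, ∀ j : Fin 4, x (i, j) = 0) {c : Fin 5 → K}
    {β : Fin 5 → ((Fin 4 × Fin 4 → K) →ₗ[K] (Fin 4 × Fin 4 → K) →ₗ[K] K)}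
    (h : ∀ u : Fin 4 × Fin 4 → K, ∀ y ∈ W, ∃ e₀ e₁ : K, ∀ s : K,
      eval (u + s • y) (perPoly (Fin 4) K) = e₀ + s * e₁ + s ^ 2 * ∑ k, c k * (β k u y) ^ 2) :
    PerDirFour W :=
  perDirFour_of_perDirFive_of_zeroRow W i hrow (perDirFive_of_jointFive h)

/-- A joint family of five squares transports to the transposed space (`jointFamily_map_transpose`, `d = 5`).
[folklore] -/
theorem jointFive_map_transposeL {W : Submodule K (Fin 4 × Fin 4 → K)} {c : Fin 5 → K}
    {β : Fin 5 → ((Fin 4 × Fin 4 → K) →ₗ[K] (Fin 4 × Fin 4 → K) →ₗ[K] K)}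
    (h : ∀ u : Fin 4 × Fin 4 → K, ∀ y ∈ W, ∃ e₀ e₁ : K, ∀ s : K,
      eval (u + s • y) (perPoly (Fin 4) K) = e₀ + s * e₁ + s ^ 2 * ∑ k, c k * (β k u y) ^ 2) :
    ∃ (c' : Fin 5 → K) (β' : Fin 5 → ((Fin 4 × Fin 4 → K) →ₗ[K] (Fin 4 × Fin 4 → K) →ₗ[K] K)),
      ∀ u : Fin 4 × Fin 4 → K,
        ∀ y ∈ W.map (transposeL (K := K) : (Fin 4 × Fin 4 → K) →ₗ[K] (Fin 4 × Fin 4 → K)),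
          ∃ e₀ e₁ : K, ∀ s : K,
            eval (u + s • y) (perPoly (Fin 4) K) = e₀ + s * e₁ + s ^ 2 * ∑ k, c' k * (β' k u y) ^ 2 :=
  jointFamily_map_transpose W c β h

/-! ## 2. The dispatch at five, over named inputs -/

section Dispatch

variable [CharZero K]

/-- **Two zero rows ⇒ no joint family of five squares** (✓ leaf R2 via the bridge, then leaf E at five `hE5`, taken as
a hypothesis: a `5`-dimensional `W ⊆ W_col(p,q;m)` carries no joint family of five squares). [folklore] -/
theorem twoZeroRows_noJointFive_of
    (hE5 : ∀ W : Submodule K (Fin 4 × Fin 4 → K), finrank K W = 5 → ∀ p q m : Fin 4, p ≠ q →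
      InWCol W p q m →
      ∀ (c : Fin 5 → K) (β : Fin 5 → ((Fin 4 × Fin 4 → K) →ₗ[K] (Fin 4 × Fin 4 → K) →ₗ[K] K)),
        ¬ (∀ u : Fin 4 × Fin 4 → K, ∀ y ∈ W, ∃ e₀ e₁ : K, ∀ s : K,
          eval (u + s • y) (perPoly (Fin 4) K) = e₀ + s * e₁ + s ^ 2 * ∑ k, c k * (β k u y) ^ 2))
    (W : Submodule K (Fin 4 × Fin 4 → K)) (h5 : finrank K W = 5) (h2 : TwoZeroRows W)
    (c : Fin 5 → K) (β : Fin 5 → ((Fin 4 × Fin 4 → K) →ₗ[K] (Fin 4 × Fin 4 → K) →ₗ[K] K))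
    (hJ : ∀ u : Fin 4 × Fin 4 → K, ∀ y ∈ W, ∃ e₀ e₁ : K, ∀ s : K,
      eval (u + s • y) (perPoly (Fin 4) K) = e₀ + s * e₁ + s ^ 2 * ∑ k, c k * (β k u y) ^ 2) :
    False := by
  obtain ⟨p, q, hpq, hW⟩ := h2
  -- row `p` vanishes on `W`: the bridge gives `PerDirFour W`
  have hPD : PerDirFour W := perDirFour_of_jointFive_of_zeroRow (i := p) (fun x hx j => (hW x hx j).1) hJ
  obtain ⟨p', q', m, hpq', hWc⟩ := leafR2 W h5 ⟨p, q, hpq, hW⟩ hPD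
  exact hE5 W h5 p' q' m hpq' hWc c β hJ

/-- **ROW BRANCH at five**: a `5`-dimensional singular `W` with a zero row carries no joint family of FIVE squares —
the bridge turns the joint five family into `PerDirFour W`, so ✓ `leafX`, ✓ `leafR2`, ✓ `leafR1C` and ✓ `threeRowsFourCols`
(leaf R1N with its residual) apply BY NAME; the five-square inputs are the `V₅×` brick `hXT5` and leaf E at five `hE5`.
[folklore] -/
theorem rowBranch_five_of
    (hXT5 : ∀ W : Submodule K (Fin 4 × Fin 4 → K), VFiveCrossType W →
      ∀ (c : Fin 5 → K) (β : Fin 5 → ((Fin 4 × Fin 4 → K) →ₗ[K] (Fin 4 × Fin 4 → K) →ₗ[K] K)),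
        ¬ (∀ u : Fin 4 × Fin 4 → K, ∀ y ∈ W, ∃ e₀ e₁ : K, ∀ s : K,
          eval (u + s • y) (perPoly (Fin 4) K) = e₀ + s * e₁ + s ^ 2 * ∑ k, c k * (β k u y) ^ 2))
    (hE5 : ∀ W : Submodule K (Fin 4 × Fin 4 → K), finrank K W = 5 → ∀ p q m : Fin 4, p ≠ q →
      InWCol W p q m →
      ∀ (c : Fin 5 → K) (β : Fin 5 → ((Fin 4 × Fin 4 → K) →ₗ[K] (Fin 4 × Fin 4 → K) →ₗ[K] K)),
        ¬ (∀ u : Fin 4 × Fin 4 → K, ∀ y ∈ W, ∃ e₀ e₁ : K, ∀ s : K,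
          eval (u + s • y) (perPoly (Fin 4) K) = e₀ + s * e₁ + s ^ 2 * ∑ k, c k * (β k u y) ^ 2)) :
    ∀ W : Submodule K (Fin 4 × Fin 4 → K), Sing3 W → finrank K W = 5 →
      (∃ i : Fin 4, ∀ x ∈ W, ∀ j : Fin 4, x (i, j) = 0) →
      ∀ (c : Fin 5 → K) (β : Fin 5 → ((Fin 4 × Fin 4 → K) →ₗ[K] (Fin 4 × Fin 4 → K) →ₗ[K] K)),
        ¬ (∀ u : Fin 4 × Fin 4 → K, ∀ y ∈ W, ∃ e₀ e₁ : K, ∀ s : K,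
          eval (u + s • y) (perPoly (Fin 4) K) = e₀ + s * e₁ + s ^ 2 * ∑ k, c k * (β k u y) ^ 2) := by
  intro W hS h5 hrow c β hJ
  obtain ⟨i, hi⟩ := hrow
  have hPD : PerDirFour W := perDirFour_of_jointFive_of_zeroRow hi hJ
  by_cases hXc : InCross W
  · exact hXT5 W (leafX W h5 hXc hPD) c β hJ
  by_cases h2 : TwoZeroRows W
  · exact twoZeroRows_noJointFive_of hE5 W h5 h2 c β hJ
  by_cases h2c : TwoZeroCols W
  · -- transpose: two zero columns become two zero rows
    set W' := W.map (transposeL (K := K) : (Fin 4 × Fin 4 → K) →ₗ[K] (Fin 4 × Fin 4 → K)) with hW'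
    have h5' : finrank K W' = 5 := by rw [hW', finrank_map_transposeL]; exact h5
    obtain ⟨c', β', hJ'⟩ := jointFive_map_transposeL hJ
    exact twoZeroRows_noJointFive_of hE5 W' h5' (twoZeroRows_map_transposeL h2c) c' β' hJ'
  by_cases hzc : ∃ j : Fin 4, ∀ x ∈ W, ∀ i : Fin 4, x (i, j) = 0
  · exact leafR1C W hS h5 ⟨i, hi⟩ hzc h2 h2c hXc hPD
  · exact threeRowsFourCols W hS h5 ⟨i, hi⟩ hzc h2 hXc hPD

/-- **THE DISPATCH AT FIVE (kernel-checked over named inputs)**: ✓ `zeroLine` (T5) + the zero-row bridge + the ✓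
four-square leaves + the three five-square inputs ⇒ no `5`-dimensional `W ⊆ Sing Z(per₄)` carries a joint family of
FIVE squares.  `hX5` = leaf X at five (per-direction family of five squares on a cross ⇒ `V₅×`-type), `hXT5` = the
`V₅×` brick at five, `hE5` = leaf E at five (no joint family of five squares on a `5`-dimensional `W ⊆ W_col(p,q;m)`).
[folklore] -/
theorem noJointFamily_five_five_of
    (hX5 : ∀ W : Submodule K (Fin 4 × Fin 4 → K), finrank K W = 5 → InCross W →
      (∀ y ∈ W, ∃ (c : Fin 5 → K) (Λ : Fin 5 → ((Fin 4 × Fin 4 → K) →ₗ[K] K)),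
        ∀ u : Fin 4 × Fin 4 → K, ∃ e₀ e₁ : K, ∀ s : K,
          eval (u + s • y) (perPoly (Fin 4) K) = e₀ + s * e₁ + s ^ 2 * ∑ k, c k * (Λ k u) ^ 2) →
      VFiveCrossType W)
    (hXT5 : ∀ W : Submodule K (Fin 4 × Fin 4 → K), VFiveCrossType W →
      ∀ (c : Fin 5 → K) (β : Fin 5 → ((Fin 4 × Fin 4 → K) →ₗ[K] (Fin 4 × Fin 4 → K) →ₗ[K] K)),
        ¬ (∀ u : Fin 4 × Fin 4 → K, ∀ y ∈ W, ∃ e₀ e₁ : K, ∀ s : K,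
          eval (u + s • y) (perPoly (Fin 4) K) = e₀ + s * e₁ + s ^ 2 * ∑ k, c k * (β k u y) ^ 2))
    (hE5 : ∀ W : Submodule K (Fin 4 × Fin 4 → K), finrank K W = 5 → ∀ p q m : Fin 4, p ≠ q →
      InWCol W p q m →
      ∀ (c : Fin 5 → K) (β : Fin 5 → ((Fin 4 × Fin 4 → K) →ₗ[K] (Fin 4 × Fin 4 → K) →ₗ[K] K)),
        ¬ (∀ u : Fin 4 × Fin 4 → K, ∀ y ∈ W, ∃ e₀ e₁ : K, ∀ s : K,
          eval (u + s • y) (perPoly (Fin 4) K) = e₀ + s * e₁ + s ^ 2 * ∑ k, c k * (β k u y) ^ 2)) :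
    ∀ W : Submodule K (Fin 4 × Fin 4 → K), Sing3 W → finrank K W = 5 →
      ∀ (c : Fin 5 → K) (β : Fin 5 → ((Fin 4 × Fin 4 → K) →ₗ[K] (Fin 4 × Fin 4 → K) →ₗ[K] K)),
        ¬ (∀ u : Fin 4 × Fin 4 → K, ∀ y ∈ W, ∃ e₀ e₁ : K, ∀ s : K,
          eval (u + s • y) (perPoly (Fin 4) K) = e₀ + s * e₁ + s ^ 2 * ∑ k, c k * (β k u y) ^ 2) := by
  intro W hS h5 c β hJ
  rcases zeroLine W hS (by rw [h5]) with hXc | ⟨i, hi⟩ | ⟨j, hj⟩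
  · exact hXT5 W (hX5 W h5 hXc (perDirFive_of_jointFive hJ)) c β hJ
  · exact rowBranch_five_of hXT5 hE5 W hS h5 ⟨i, hi⟩ c β hJ
  · -- zero column: transpose
    set W' := W.map (transposeL (K := K) : (Fin 4 × Fin 4 → K) →ₗ[K] (Fin 4 × Fin 4 → K)) with hW'
    have h5' : finrank K W' = 5 := by rw [hW', finrank_map_transposeL]; exact h5
    obtain ⟨c', β', hJ'⟩ := jointFive_map_transposeL hJ
    exact rowBranch_five_of hXT5 hE5 W' (sing3_map_transposeL hS) h5'
      ⟨j, zeroRow_map_transposeL hj⟩ c' β' hJ'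

end Dispatch

end Summit.ValiantsHypothesis.ValiantsHypothesis.Theorems.SymPencilSingFiveClassificationFive
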